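import Literature.AlgebraicGeometry.Resolution.ArithmeticalThreefoldsClimbOfGeneral
import Literature.AlgebraicGeometry.Resolution.EmbeddedResolutionExcellentSurfacesOfHistory
import Summits.ResolutionOfSingularities.ResolutionOfSingularities.Theorems.RadicialJungCleanModelsStubCossartPiltant2019OfNamedPushDown
import HarnessLib

/-!
# The two `@[conjecture]` push-down statements of stub 2 ([CoP1] Lemma 9.4 Kummer core, [CoP1] Prop. 9.3) are
# COROLLARIES of Cossart–Piltant 2019 Thm. 1.1 as printed

OURS (decomp-res hand-1 g21; crux `stmt-ResolutionOfSingularities-15917`, skeleton rev 35, stub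
`stub_cossartPiltant2019 : CossartPiltant2019.{0}`).  The hand-1 g20 leaf list of stub 2 names two printed statements with
incomplete printed proofs, carried as `@[conjecture] def`s: `CossartPiltant2008_lemma94_kummerCore` and
`CossartPiltant2008_prop93` (`RadicialJungCleanModelsStubCossartPiltant2019OfNamedPushDown.lean`).  Both conclude a local
uniformization, in the tree's currency, of a subfield `A ∋ S` (resp. `M ∋ S`) of `E` lying inside a FINITELY GENERATED subfield
that is already uniformized.  The Literature theorem `CossartPiltant2019General.climb` (`ArithmeticalThreefoldsClimbOfGeneral.lean`,
same generation: the climbing statement of CP 2019 Prop. 4.10 from Thm. 1.1 as printed) uniformizes EVERY finitely generated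
subfield; so both statements follow from `CossartPiltant2019General` once the subfield is shown to be finitely generated over
`Frac S` — which it is, being an intermediate field of a finite extension (`exists_finset_le_closure_of_le_closure`).

* `exists_finset_le_closure_of_le_closure` — a subfield `A ∋ S` inside `F(t)` (`t` finite, `E` algebraic over `S`) is `F(g)`-generated
  for a finite `g ⊆ A` (in the weak form `g ⊆ A ≤ F(g)`);
* `lemma94KummerCore_of_general : CossartPiltant2019General.{u} → CossartPiltant2008_lemma94_kummerCore.{u}`;
* `prop93_of_general : CossartPiltant2019General.{u} → CossartPiltant2008_prop93.{u}`.

Reading for the census: the `@[conjecture]` tags flag PRINTED PROOFS, not doubtful STATEMENTS — both statements are theorems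
modulo `CossartPiltant2019General` (= `CP2019.CossartPiltant2019Thm11.general`, CP 2019 Thm. 1.1 verbatim), the parent of stub 2's
own type; a refuter has nothing to attack in them.  In the paper the logic runs the other way (Thm. 1.1 is deduced from the climb
through these push-downs), so this records trust bases, not a proof of Thm. 1.1.  Nothing here proves resolution in
characteristic `p`; rung 0.  AI-written; AI review weaker than expert review.
-/

noncomputable section

-- `Summit.ResolutionOfSingularities.ResolutionOfSingularities` (summit = problem) duplicates a namespace component by design (D-0017).
set_option linter.dupNamespace false

open IsLocalRing Polynomial
open _root_.IntermediateField
open Literature.AlgebraicGeometry.Resolution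

namespace Summit.ResolutionOfSingularities.ResolutionOfSingularities.Theorems.RadicialJung.CleanModels

universe u

/-- **An intermediate field of a finitely generated algebraic extension is finitely generated** (weak form used here): if
`S → E` is injective with `E` algebraic over `S`, `A` is a subfield of `E` containing `S`, and `A ⊆ F(t)` for a finite `t ⊆ E`
(`F(t)` = the subfield generated by `S` and `t`), then `g ⊆ A ⊆ F(g)` for some finite `g` — an `F`-basis of `A` inside the
finite-dimensional `F(t)`, `F = Frac S` realised as the subfield generated by `S`. [folklore] -/
theorem exists_finset_le_closure_of_le_closure {S E : Type u} [CommRing S] [Field E] [Algebra S E]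
    [Algebra.IsAlgebraic S E] (hinj : Function.Injective (algebraMap S E))
    (A : Subfield E) (hSA : ∀ s : S, algebraMap S E s ∈ A) (t : Finset E)
    (hAt : A ≤ Subfield.closure (Set.range (algebraMap S E) ∪ (t : Set E))) :
    ∃ g : Finset E, (g : Set E) ⊆ A ∧
      A ≤ Subfield.closure (Set.range (algebraMap S E) ∪ (g : Set E)) := by
  classical
  -- the subfield `F' = F` generated by `S`, and `A`, `F(t)` as intermediate fields over it
  let F' : Subfield E := Subfield.closure (Set.range (algebraMap S E))
  have hF'A : F' ≤ A := Subfield.closure_le.2 (Set.range_subset_iff.2 hSA)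
  have hF'mem : ∀ x : F', algebraMap F' E x ∈ A := fun x => hF'A x.2
  let A' : IntermediateField F' E := A.toIntermediateField hF'mem
  let N : IntermediateField F' E := IntermediateField.adjoin F' (t : Set E)
  have hle : Subfield.closure (Set.range (algebraMap S E) ∪ (t : Set E)) ≤ N.toSubfield := by
    refine Subfield.closure_le.2 (Set.union_subset ?_ ?_)
    · rintro _ ⟨s, rfl⟩
      exact N.algebraMap_mem ⟨algebraMap S E s, Subfield.subset_closure ⟨s, rfl⟩⟩
    · exact IntermediateField.subset_adjoin F' (t : Set E)
  have hA'N : A' ≤ N := fun x hx => hle (hAt hx)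
  -- `F(t)` is finite-dimensional over `F`, hence so is `A`
  letI : Algebra S F' :=
    ((algebraMap S E).codRestrict F' fun s => Subfield.subset_closure ⟨s, rfl⟩).toAlgebra
  haveI : IsScalarTower S F' E := IsScalarTower.of_algebraMap_eq fun _ => rfl
  have hinjF : Function.Injective (algebraMap S F') := fun a b h =>
    hinj (congrArg (fun z : F' => (z : E)) h)
  haveI : FiniteDimensional F' N := IntermediateField.finiteDimensional_adjoin fun x _ =>
    ((Algebra.IsAlgebraic.isAlgebraic (R := S) x).extendScalars hinjF).isIntegral
  haveI : FiniteDimensional F' A' := FiniteDimensional.of_injective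
    (IntermediateField.inclusion hA'N).toLinearMap (IntermediateField.inclusion_injective hA'N)
  obtain ⟨s, hs⟩ := Module.finite_def.mp ‹FiniteDimensional F' A'›
  refine ⟨s.image (fun x : A' => (x : E)), ?_, ?_⟩
  · intro y hy
    rw [Finset.coe_image] at hy
    obtain ⟨x, -, rfl⟩ := hy
    exact x.2
  · intro a ha
    have hmem : (⟨a, ha⟩ : A') ∈ Submodule.span F' (s : Set A') := by
      rw [hs]; exact Submodule.mem_top
    have hF'le : F' ≤ Subfield.closure (Set.range (algebraMap S E) ∪
        ((s.image fun x : A' => (x : E) : Finset E) : Set E)) :=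
      Subfield.closure_mono Set.subset_union_left
    have key : ∀ x : A', x ∈ Submodule.span F' (s : Set A') → (x : E) ∈ Subfield.closure
        (Set.range (algebraMap S E) ∪ ((s.image fun x : A' => (x : E) : Finset E) : Set E)) := by
      intro x hx
      refine Submodule.span_induction
        (p := fun (x : A') (_ : x ∈ Submodule.span F' (s : Set A')) => (x : E) ∈ Subfield.closure
          (Set.range (algebraMap S E) ∪ ((s.image fun x : A' => (x : E) : Finset E) : Set E)))
        ?_ ?_ ?_ ?_ hx
      · intro x hx
        refine Subfield.subset_closure (Or.inr ?_)
        rw [Finset.coe_image]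
        exact ⟨x, hx, rfl⟩
      · simp
      · intro x y _ _ hx hy
        rw [IntermediateField.coe_add]
        exact add_mem hx hy
      · intro c x _ hx
        rw [IntermediateField.coe_smul, Algebra.smul_def]
        exact mul_mem (hF'le c.2) hx
    exact key ⟨a, ha⟩ hmem

/-- **[CoP1] Lemma 9.4 (Kummer core) is a corollary of Cossart–Piltant 2019 Thm. 1.1 as printed.**  In the frame of
`CossartPiltant2008_lemma94_kummerCore` the subfield `A` lies inside the uniformized, finitely generated `A(θ) = F(t)`, so `A` is
finitely generated over `Frac S` (`exists_finset_le_closure_of_le_closure`), and `CossartPiltant2019General.climb` uniformizes it at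
`O_E ∩ A`.  (None of the Kummer data — `ℓ`, `ζ`, `θ`, inertia, rank one — is used.)
[cite: CossartPiltant2019, Thm. 1.1 with §4.1 (LU)] [cite: CossartPiltant2008, Lemma 9.4] -/
theorem lemma94KummerCore_of_general (hG : CossartPiltant2019General.{u}) :
    CossartPiltant2008_lemma94_kummerCore.{u} := by
  intro p hp S _ _ _ hS hdim hchar hcomp E _ _ hinj hE halg OE hSO hdom hres hrk ℓ hℓ hℓp ζ hζ A hSA hζA
    θ hθA hθℓ hvθ hdeg hgal hinert hLU
  obtain ⟨t, -, hAt, -⟩ := hLU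
  haveI := halg
  have hA : A ≤ Subfield.closure (Set.range (algebraMap S E) ∪ (t : Set E)) := fun x hx =>
    hAt ((IntermediateField.adjoin A ({θ} : Set E)).algebraMap_mem ⟨x, hx⟩)
  obtain ⟨g, hgA, hAg⟩ := exists_finset_le_closure_of_le_closure hinj A hSA t hA
  obtain ⟨t', ht'g, hgt', hTO, hreg⟩ := hG.climb hS hdim.le hinj OE hSO hdom hres g
  refine ⟨t', ?_, ?_, hTO, hreg⟩
  · have hle : Subfield.closure (Set.range (algebraMap S E) ∪ (g : Set E)) ≤ A :=
      Subfield.closure_le.2 (Set.union_subset (Set.range_subset_iff.2 hSA) hgA)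
    exact fun x hx => hle (ht'g hx)
  · exact hAg.trans (Subfield.closure_le.2 (Set.union_subset
      (fun x hx => Subfield.subset_closure (Or.inl hx)) hgt'))

/-- **[CoP1] Prop. 9.3 is a corollary of Cossart–Piltant 2019 Thm. 1.1 as printed.**  In the frame of `CossartPiltant2008_prop93`
the subfield `M` lies inside the uniformized, finitely generated `K' = F(t)`, so `M` is finitely generated over `Frac S` and
`CossartPiltant2019General.climb` uniformizes it at `O_E ∩ M`.  (None of the Galois / inertia data is used.)
[cite: CossartPiltant2019, Thm. 1.1 with §4.1 (LU)] [cite: CossartPiltant2008, Prop. 9.3] -/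
theorem prop93_of_general (hG : CossartPiltant2019General.{u}) : CossartPiltant2008_prop93.{u} := by
  intro p hp S _ _ _ hS hdim hchar hcomp E _ _ hinj hE halg OE hSO hdom hres hrk M hSM N _ _ K' hMK' hK'i
    hLU
  obtain ⟨t, -, hK't, -⟩ := hLU
  haveI := halg
  have hM : M ≤ Subfield.closure (Set.range (algebraMap S E) ∪ (t : Set E)) := hMK'.trans hK't
  obtain ⟨g, hgM, hMg⟩ := exists_finset_le_closure_of_le_closure hinj M hSM t hM
  obtain ⟨t', ht'g, hgt', hTO, hreg⟩ := hG.climb hS hdim.le hinj OE hSO hdom hres g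
  refine ⟨t', ?_, ?_, hTO, hreg⟩
  · have hle : Subfield.closure (Set.range (algebraMap S E) ∪ (g : Set E)) ≤ M :=
      Subfield.closure_le.2 (Set.union_subset (Set.range_subset_iff.2 hSM) hgM)
    exact fun x hx => hle (ht'g hx)
  · exact hMg.trans (Subfield.closure_le.2 (Set.union_subset
      (fun x hx => Subfield.subset_closure (Or.inl hx)) hgt'))

/-- **Hence the TYPE of stub 2 from {CP 2019 Thm. 1.5, F-72, Hironaka (char 0)} and Thm. 1.1 as printed standing in for the two
push-downs** — i.e. every named input of `cossartPiltant2019_of_history_of_lemma94_of_prop93_of_hironaka` other than Thm. 1.5, F-72 and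
Hironaka is discharged by `CossartPiltant2019General` (which of course also gives the type of stub 2 directly,
`CossartPiltant2019General.cossartPiltant2019'`; recorded to make the census statement «the gappy leaves add nothing to the trust base
{Thm. 1.1}» a kernel fact). [cite: CossartPiltant2019, Thm. 1.1, Thm. 1.5] [cite: CossartPiltant2008, Lemma 9.4, Prop. 9.3] -/
theorem cossartPiltant2019_of_history_of_general_of_hironaka
    (hloc : CossartPiltant2019Local.{0}) (h72 : CossartJannsenSaito2020_canonicalSequence_history.{0})
    (hG : CossartPiltant2019General.{0}) (hH : Hironaka1964_local.{0}) : CossartPiltant2019.{0} :=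
  cossartPiltant2019_of_stub1_of_lemma94_of_prop93_of_hironaka hloc
    (CossartJannsenSaito2020Embedded.of_canonicalSequence_history h72)
    (lemma94KummerCore_of_general hG) (prop93_of_general hG) hH

end Summit.ResolutionOfSingularities.ResolutionOfSingularities.Theorems.RadicialJung.CleanModels

end
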